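import Literature.MathematicalPhysics.QuantumFieldTheory.ConformalBootstrap3D.PointKernelK34Data

/-!
# K34 certificate, kernel block file M1: (M) rows `11 ≤ j < 21` of `mrows`, in 10 row groups

`decide` by kernel reduction (no `native_decide`, no extra axioms) of the block checker of
`PointKernel` on the literal data of `PointKernelK34Data`; soundness is `PCert.mBlockOK_sound`.
Estimated kernel time 168 s (10 theorems).
-/

set_option maxRecDepth 100000
set_option maxHeartbeats 0

namespace Literature.MathematicalPhysics.QuantumFieldTheory.ConformalBootstrap3D.PointKernelK34

open Literature.MathematicalPhysics.QuantumFieldTheory.ConformalBootstrap3D.PointKernel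

/-- (M) rows `[11, 12)` pass the kernel evaluator. [folklore] -/
theorem mBlock_11 : cert.mBlockOK mrows 11 12 = true := by
  decide +kernel

/-- (M) rows `[12, 13)` pass the kernel evaluator. [folklore] -/
theorem mBlock_12 : cert.mBlockOK mrows 12 13 = true := by
  decide +kernel

/-- (M) rows `[13, 14)` pass the kernel evaluator. [folklore] -/
theorem mBlock_13 : cert.mBlockOK mrows 13 14 = true := by
  decide +kernel

/-- (M) rows `[14, 15)` pass the kernel evaluator. [folklore] -/
theorem mBlock_14 : cert.mBlockOK mrows 14 15 = true := by
  decide +kernel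

/-- (M) rows `[15, 16)` pass the kernel evaluator. [folklore] -/
theorem mBlock_15 : cert.mBlockOK mrows 15 16 = true := by
  decide +kernel

/-- (M) rows `[16, 17)` pass the kernel evaluator. [folklore] -/
theorem mBlock_16 : cert.mBlockOK mrows 16 17 = true := by
  decide +kernel

/-- (M) rows `[17, 18)` pass the kernel evaluator. [folklore] -/
theorem mBlock_17 : cert.mBlockOK mrows 17 18 = true := by
  decide +kernel

/-- (M) rows `[18, 19)` pass the kernel evaluator. [folklore] -/
theorem mBlock_18 : cert.mBlockOK mrows 18 19 = true := by
  decide +kernel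

/-- (M) rows `[19, 20)` pass the kernel evaluator. [folklore] -/
theorem mBlock_19 : cert.mBlockOK mrows 19 20 = true := by
  decide +kernel

/-- (M) rows `[20, 21)` pass the kernel evaluator. [folklore] -/
theorem mBlock_20 : cert.mBlockOK mrows 20 21 = true := by
  decide +kernel

end Literature.MathematicalPhysics.QuantumFieldTheory.ConformalBootstrap3D.PointKernelK34
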